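import Summits.QuantumFields.BalabanUV.T4Continuum.Support.NE9TablePolydiscSP

/-!
# NE9TablePolydiscSPSharp — ROUTE R3′♯-SP, PART 3 (SHARPNESS): the table-polydisc Schwarz–Pick constant `M·R₀∕(R₀² − s₀²)` of
# PART 1 `NE9TablePolydiscSP.norm_sub_le_of_polydiscSP` is the FLOOR of its data class {`f : ℓ^∞(A;ℂ) → ℂ` holomorphic on the
# ball `‖Q‖ < R₀`, `‖f‖ ≤ M` there; tables in the closed `s₀`-polydisc} — a coordinate Möbius map attains it in the limit; the refuter's
# prediction P-R3-8 ∕ PRICING-NE9 v10 §B(B10-2) («SHARP … below it only with MORE data») as a kernel theorem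

Cell `pub-balaban`, T4-DAG §6 row NE9; NE9 crux team (coordinator ruling «YM REDIRECT» e34b3e0c (2)), leaf lineage
`b2b-balaban-t4-ne9-formalise-leaf-06` generation 40; route R3′ «pencil ∕ potential-KPG», ADDENDUM «R3′♯-SP» of `t4/ROUTES-NE9.md` v8.0.1∕v9.0.1
§L1.3 (idea-1); companion of PART 1 `NE9TablePolydiscSP` (engine, idea-1 g8's scratch 1bacbd220ebeef05 §1–§2) and PART 2 `NE9TablePolydiscSPEnd`
(E129's END re-threaded).  THIS PART is leaf-06's own (journal PROPOSED l.30076 announced it): the pricing desk wrote (B10-2) «the coordinate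
Möbius map φ_a ∘ π_β, |a| = s₀∕R₀, has derivative modulus exactly R₀∕(R₀² − s₀²)·M at the point of modulus s₀ ⇒ M·R₀∕(R₀² − s₀²) is the floor of
the table-half Lipschitz constant for the data class …; below it only with MORE data (a bound on |g(Q)| away from M, i.e. a displayed oscillation
letter — none typed)» and ENDORSED idea-1's P-R3-8; here that sentence is a theorem: for every `C` below the constant there is an admissible `f`
and two admissible tables at which the difference quotient EXCEEDS `C`.  Consequence for the week-1 cell (T17′ «END-side saturation is
CLASS-RELATIVE»): on route R3′'s side the SP END (PART 2) is saturated for its STATED data class at the kernel level, exactly as leaf-03's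
`NE9PolydiscChain.not_lipschitz_below` (p255595) certifies the prefactor `1∕(1−θ²)` on route R4♯'s side; a further table-half gain on R3′ needs NEW
DATA (T15: an oscillation ∕ one-cluster-sum letter), not a better lemma.

THE WITNESS.  `σ := s₀∕R₀ ∈ (0,1)`, one coordinate `β : A`, `f(Q) := M · M_σ(Q_β∕R₀)` with `M_σ(v) = (v − σ)∕(1 − σv)` the disc automorphism
of `Literature.Analysis.Complex.SchwarzPickNearBoundary` (`moebius`): holomorphic on the ball (the coordinate `Q ↦ Q_β` is Mathlib's CLM
`lp.evalCLM`, `|Q_β|∕R₀ < 1` there, `differentiableOn_moebius`), bounded by `M` (`norm_moebius_le`).  Tables `Q := s₀·e_β`, `Q′ := (s₀ − h)·e_β`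
(`lp.single`), `0 < h ≤ s₀∕2`: `‖Q‖ = s₀`, `‖Q′‖ = s₀ − h`, `‖Q − Q′‖ = h`, `f Q = M·M_σ(σ) = 0`, `f Q′ = −M·h·R₀∕(R₀² − s₀² + s₀h)`, so the
quotient is `M·R₀∕(R₀² − s₀² + s₀h)`, which exceeds any `C < M·R₀∕(R₀² − s₀²)` once `h` is small (explicitly: `h < (M·R₀∕C′ − (R₀² − s₀²))∕s₀`
with `C′ := max C (K∕2)`, `K` the constant).  The degenerate box `s₀ = 0` is excluded (the closed `0`-polydisc is a point; PART 1's bound is then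
vacuous and trivially sharp in the other sense).

HONEST FRAMING (T4-DAG PAGE 1).  Rung (B)+1 of the FINITE-VOLUME T⁴ programme — NOT infinite volume, NOT a mass gap, NOT the Clay problem.  NE9
(`T4OutputRate.NE9` ∧ `FadingMemory`) is a cell NEW ESTIMATE, NOT PRINTED in [I] = [Balaban1987RG1] (CMP **109**), [II] = [Balaban1988RG2Cluster]
(CMP **116**), NOT PROVED for Bałaban's E^{(j)} («NE9 ⇐ the named binders»; row WALLED ON A MODEL O-NE9-1; spine PROVED 0∕9).  A sharpness lemma
about a CONSTANT inside a CONDITIONAL END says nothing about the estimate itself; it only closes the question «can the table-half lemma be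
improved on the same displayed data» (no).  HONEST DEPENDENCY (cell line, verbatim): continuum YM on T⁴ ⇐ BetaPertH ∧ nine spine estimates (0/9
proved); BetaPertH ⇐ (D1) ∧ (D4) ∧ CAP+tail; G-an2-4 gates asym, D1 and NE2/3/4.  `FlowStep.BetaPertH`, (B), (B^μ) do not occur; nothing of
[I]∕[II] is used, even for types.

CONTENT ([folklore]; 0 def, 0 Prop-valued definition, 0 sorry):
* `moebius_ofReal_ofReal` — `M_σ(a) = (a − σ)∕(1 − σa)` for real `σ`, `a` (cast bookkeeping).
* **`polydiscSP_constant_sharp`** — `∀ C < M·R₀∕(R₀² − s₀²)` (`0 < M`, `0 < s₀ < R₀`, `β : A`): `∃ f, DifferentiableOn ℂ f (ball 0 R₀) ∧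
  (∀ Q ∈ ball 0 R₀, ‖f Q‖ ≤ M) ∧ ∃ Q Q′, ‖Q‖ ≤ s₀ ∧ ‖Q′‖ ≤ s₀ ∧ Q ≠ Q′ ∧ C·‖Q − Q′‖ < ‖f Q − f Q′‖`.
DISGUISE TEST: one-variable complex analysis (a Möbius map) on one coordinate of `ℓ^∞(A;ℂ)`; no cluster expansion, no history, nothing of
Bałaban's; not NE9.  WHAT THIS DOES NOT DO: it does not say the END's RATE is optimal for Bałaban's terms (whose activities may carry more structure
than the data class displays — T15), nor anything about the coupling half, the model O-NE9-1 or the displays `z`, `S`.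

References: [FV1980] T. Franzoni, E. Vesentini, *Holomorphic Maps and Invariant Distances*, North-Holland Math. Studies 40 (1980), ch. V §5
(polydisc Schwarz–Pick; automorphisms of the polydisc); [Harris1979] L. A. Harris, North-Holland Math. Studies 34 (1979) 345–406.
Summits-side NEW work (LEAN PLACEMENT RULE); imports PART 1 `NE9TablePolydiscSP` (hence leaf-03's `NE9PolydiscSchwarzPick` and the Literature
Möbius map) BY NAME; modifies nothing; 0 sorry.  Value = the R3′-side sharpness witness for the refuter's T17′ ledger, NOT summit progress.
-/

noncomputable section

namespace Summit.QuantumFields.BalabanUV.T4Continuum.NE9TablePolydiscSPSharp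

open Metric Set
open scoped ENNReal ComplexConjugate
open Literature.Analysis.Complex.SchwarzPick (moebius moebius_self norm_moebius_le differentiableOn_moebius denom_ne_zero)
open Summit.QuantumFields.BalabanUV.T4Continuum.NE9PolydiscSchwarzPick (norm_coordFn_le)

variable {A : Type*}

/-- The Möbius map with REAL centre `σ` at a REAL point `a`: `M_σ(a) = (a − σ)∕(1 − σa)` (a real number). [folklore] -/
theorem moebius_ofReal_ofReal (σ a : ℝ) :
    moebius (σ : ℂ) (a : ℂ) = (((a - σ) / (1 - σ * a) : ℝ) : ℂ) := by
  unfold moebius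
  rw [Complex.conj_ofReal]
  push_cast
  rfl

/-- **SHARPNESS OF THE TABLE-POLYDISC SCHWARZ–PICK CONSTANT** (refuter PRICING-NE9 v10 §B(B10-2) ∕ prediction P-R3-8, kernel form):
the constant `M·R₀∕(R₀² − s₀²)` of `NE9TablePolydiscSP.norm_sub_le_of_polydiscSP` cannot be lowered on its data class — for every
`C < M·R₀∕(R₀² − s₀²)` (`0 < M`, `0 < s₀ < R₀`, one coordinate `β`) there are `f : ℓ^∞(A;ℂ) → ℂ` holomorphic on the ball
`‖Q‖ < R₀` with `‖f‖ ≤ M` there and two tables `Q ≠ Q′` in the closed `s₀`-polydisc with `C·‖Q − Q′‖ < ‖f Q − f Q′‖`.  Witness: the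
coordinate Möbius map `f(Q) = M·M_σ(Q_β∕R₀)`, `σ = s₀∕R₀`, read at `Q = s₀e_β` and `Q′ = (s₀ − h)e_β` for small `h > 0`, where
`‖f Q − f Q′‖∕‖Q − Q′‖ = M·R₀∕(R₀² − s₀² + s₀h) ↑ M·R₀∕(R₀² − s₀²)`. [folklore; FV1980 ch. V §5] -/
theorem polydiscSP_constant_sharp (β : A) {M R₀ s₀ C : ℝ} (hM : 0 < M) (hs₀ : 0 < s₀) (hsR : s₀ < R₀)
    (hC : C < M * R₀ / (R₀ ^ 2 - s₀ ^ 2)) :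
    ∃ f : lp (fun _ : A => ℂ) ∞ → ℂ, DifferentiableOn ℂ f (ball 0 R₀) ∧
      (∀ Q ∈ ball (0 : lp (fun _ : A => ℂ) ∞) R₀, ‖f Q‖ ≤ M) ∧
      ∃ Q Q' : lp (fun _ : A => ℂ) ∞, ‖Q‖ ≤ s₀ ∧ ‖Q'‖ ≤ s₀ ∧ Q ≠ Q' ∧ C * ‖Q - Q'‖ < ‖f Q - f Q'‖ := by
  classical
  have hR : 0 < R₀ := hs₀.trans hsR
  have hRne : R₀ ≠ 0 := hR.ne'
  have hD : 0 < R₀ ^ 2 - s₀ ^ 2 := by nlinarith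
  set σ : ℝ := s₀ / R₀ with hσ
  have hσ0 : 0 < σ := div_pos hs₀ hR
  have hσ1 : σ < 1 := (div_lt_one hR).2 hsR
  have hσC : ‖(σ : ℂ)‖ < 1 := by rw [Complex.norm_real, Real.norm_of_nonneg hσ0.le]; exact hσ1
  -- the extremal function
  set f : lp (fun _ : A => ℂ) ∞ → ℂ := fun Q => (M : ℂ) * moebius (σ : ℂ) ((R₀ : ℂ)⁻¹ * Q β) with hf
  have hlin : Differentiable ℂ fun Q : lp (fun _ : A => ℂ) ∞ => (R₀ : ℂ)⁻¹ * Q β := fun Q =>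
    ((lp.evalCLM ℂ (fun _ : A => ℂ) ∞ β).differentiableAt).const_mul _
  have hmaps : MapsTo (fun Q : lp (fun _ : A => ℂ) ∞ => (R₀ : ℂ)⁻¹ * Q β) (ball 0 R₀) (ball 0 1) := by
    intro Q hQ
    rw [mem_ball_zero_iff] at hQ ⊢
    rw [norm_mul, norm_inv, Complex.norm_real, Real.norm_of_nonneg hR.le]
    calc R₀⁻¹ * ‖Q β‖ ≤ R₀⁻¹ * ‖Q‖ := mul_le_mul_of_nonneg_left (norm_coordFn_le Q β) (inv_nonneg.2 hR.le)
      _ < R₀⁻¹ * R₀ := mul_lt_mul_of_pos_left hQ (inv_pos.2 hR)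
      _ = 1 := inv_mul_cancel₀ hRne
  have hfd : DifferentiableOn ℂ f (ball 0 R₀) :=
    ((differentiableOn_moebius hσC).comp hlin.differentiableOn hmaps).const_mul _
  have hfM : ∀ Q ∈ ball (0 : lp (fun _ : A => ℂ) ∞) R₀, ‖f Q‖ ≤ M := by
    intro Q hQ
    have h1 := norm_moebius_le hσC (mem_ball_zero_iff.1 (hmaps hQ))
    calc ‖f Q‖ = M * ‖moebius (σ : ℂ) ((R₀ : ℂ)⁻¹ * Q β)‖ := by
          rw [hf]; dsimp only; rw [norm_mul, Complex.norm_real, Real.norm_of_nonneg hM.le]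
      _ ≤ M * 1 := mul_le_mul_of_nonneg_left h1 hM.le
      _ = M := mul_one M
  refine ⟨f, hfd, hfM, ?_⟩
  -- the step `h`: positive, `≤ s₀/2`, and small against `C' := max C (K/2)`
  have hK0 : 0 < M * R₀ / (R₀ ^ 2 - s₀ ^ 2) := div_pos (mul_pos hM hR) hD
  obtain ⟨C', hC', -⟩ : ∃ C' : ℝ, C' = max C (M * R₀ / (R₀ ^ 2 - s₀ ^ 2) / 2) ∧ True := ⟨_, rfl, trivial⟩
  have hCC' : C ≤ C' := hC' ▸ le_max_left _ _
  have hC'0 : 0 < C' := hC' ▸ lt_of_lt_of_le (by linarith) (le_max_right _ _)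
  have hC'K : C' < M * R₀ / (R₀ ^ 2 - s₀ ^ 2) := hC' ▸ max_lt hC (by linarith)
  have hgap : R₀ ^ 2 - s₀ ^ 2 < M * R₀ / C' := by
    rw [lt_div_iff₀ hC'0]
    have := (lt_div_iff₀ hD).1 hC'K
    linarith
  obtain ⟨h₁, hh₁, -⟩ : ∃ h₁ : ℝ, h₁ = (M * R₀ / C' - (R₀ ^ 2 - s₀ ^ 2)) / s₀ ∧ True := ⟨_, rfl, trivial⟩
  have hh₁0 : 0 < h₁ := hh₁ ▸ div_pos (sub_pos.2 hgap) hs₀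
  obtain ⟨h, hh, -⟩ : ∃ h : ℝ, h = min (s₀ / 2) (h₁ / 2) ∧ True := ⟨_, rfl, trivial⟩
  have hh0 : 0 < h := hh ▸ lt_min (by linarith) (by linarith)
  have hhs : h ≤ s₀ / 2 := hh ▸ min_le_left _ _
  have hhh₁ : h < h₁ := hh ▸ lt_of_le_of_lt (min_le_right _ _) (by linarith)
  have hsh : 0 ≤ s₀ - h := by linarith
  have hE : 0 < R₀ ^ 2 - s₀ ^ 2 + s₀ * h := by nlinarith
  -- the two tables
  set Q : lp (fun _ : A => ℂ) ∞ := lp.single ∞ β ((s₀ : ℝ) : ℂ) with hQ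
  set Q' : lp (fun _ : A => ℂ) ∞ := lp.single ∞ β ((s₀ - h : ℝ) : ℂ) with hQ'
  have hnQ : ‖Q‖ = s₀ := by
    rw [hQ, lp.norm_single ENNReal.zero_lt_top, Complex.norm_real, Real.norm_of_nonneg hs₀.le]
  have hnQ' : ‖Q'‖ = s₀ - h := by
    rw [hQ', lp.norm_single ENNReal.zero_lt_top, Complex.norm_real, Real.norm_of_nonneg hsh]
  have hQQ' : Q - Q' = lp.single ∞ β ((h : ℝ) : ℂ) := by
    rw [hQ, hQ', ← lp.single_sub]; congr 1; push_cast; ring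
  have hnQQ' : ‖Q - Q'‖ = h := by
    rw [hQQ', lp.norm_single ENNReal.zero_lt_top, Complex.norm_real, Real.norm_of_nonneg hh0.le]
  have hQβ : Q β = ((s₀ : ℝ) : ℂ) := by rw [hQ]; exact lp.single_apply_self _ _ _
  have hQ'β : Q' β = ((s₀ - h : ℝ) : ℂ) := by rw [hQ']; exact lp.single_apply_self _ _ _
  -- the two values
  have hfQ : f Q = 0 := by
    rw [hf]; dsimp only
    rw [hQβ, show (R₀ : ℂ)⁻¹ * ((s₀ : ℝ) : ℂ) = ((σ : ℝ) : ℂ) by rw [hσ, Complex.ofReal_div, inv_mul_eq_div],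
      moebius_self, mul_zero]
  have hval : (((s₀ - h) / R₀ - σ) / (1 - σ * ((s₀ - h) / R₀)) : ℝ) = -(h * R₀ / (R₀ ^ 2 - s₀ ^ 2 + s₀ * h)) := by
    have e1 : (s₀ - h) / R₀ - σ = -h / R₀ := by rw [hσ, div_sub_div_same]; ring_nf
    have e2 : 1 - σ * ((s₀ - h) / R₀) = (R₀ ^ 2 - s₀ ^ 2 + s₀ * h) / R₀ ^ 2 := by
      rw [hσ, eq_div_iff (pow_ne_zero 2 hRne)]
      field_simp
      ring
    have e3 : -h / R₀ * R₀ ^ 2 = -(h * R₀) := by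
      rw [div_mul_eq_mul_div, pow_two, ← mul_assoc, mul_div_cancel_right₀ _ hRne]; ring
    rw [e1, e2, div_div_eq_mul_div, e3, neg_div]
  have hfQ' : f Q' = (((-(M * (h * R₀ / (R₀ ^ 2 - s₀ ^ 2 + s₀ * h)))) : ℝ) : ℂ) := by
    rw [hf]; dsimp only
    rw [hQ'β, show (R₀ : ℂ)⁻¹ * ((s₀ - h : ℝ) : ℂ) = ((((s₀ - h) / R₀ : ℝ)) : ℂ) by
        rw [Complex.ofReal_div, inv_mul_eq_div], moebius_ofReal_ofReal, hval]
    push_cast; ring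
  have hdiff : ‖f Q - f Q'‖ = M * (h * R₀ / (R₀ ^ 2 - s₀ ^ 2 + s₀ * h)) := by
    rw [hfQ, hfQ', zero_sub, norm_neg, Complex.norm_real, Real.norm_eq_abs, abs_neg,
      abs_of_nonneg (mul_nonneg hM.le (div_nonneg (mul_nonneg hh0.le hR.le) hE.le))]
  refine ⟨Q, Q', hnQ.le, by rw [hnQ']; linarith, fun heq => ?_, ?_⟩
  · have : ‖Q - Q'‖ = 0 := by rw [heq, sub_self, norm_zero]
    rw [hnQQ'] at this; exact hh0.ne' this
  · rw [hnQQ', hdiff]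
    -- `C·h < M·h·R₀∕(R₀² − s₀² + s₀h)` from `h < h₁`
    have h2 : s₀ * h < M * R₀ / C' - (R₀ ^ 2 - s₀ ^ 2) := by
      have := mul_lt_mul_of_pos_left hhh₁ hs₀
      rwa [hh₁, mul_div_cancel₀ _ hs₀.ne'] at this
    have h3 : C' * (R₀ ^ 2 - s₀ ^ 2 + s₀ * h) < M * R₀ := by
      have := (lt_div_iff₀ hC'0).1 (by linarith : R₀ ^ 2 - s₀ ^ 2 + s₀ * h < M * R₀ / C')
      linarith [this]
    rw [show M * (h * R₀ / (R₀ ^ 2 - s₀ ^ 2 + s₀ * h)) = M * R₀ * h / (R₀ ^ 2 - s₀ ^ 2 + s₀ * h) by ring,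
      lt_div_iff₀ hE]
    calc C * h * (R₀ ^ 2 - s₀ ^ 2 + s₀ * h) ≤ C' * h * (R₀ ^ 2 - s₀ ^ 2 + s₀ * h) :=
          mul_le_mul_of_nonneg_right (mul_le_mul_of_nonneg_right hCC' hh0.le) hE.le
      _ = h * (C' * (R₀ ^ 2 - s₀ ^ 2 + s₀ * h)) := by ring
      _ < h * (M * R₀) := mul_lt_mul_of_pos_left h3 hh0
      _ = M * R₀ * h := by ring

end Summit.QuantumFields.BalabanUV.T4Continuum.NE9TablePolydiscSPSharp

end
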